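import Mathlib.LinearAlgebra.TensorProduct.Basis
import Mathlib.RepresentationTheory.Basic

/-!
# `V ⊗ W` with `G` acting on `V` alone is a direct sum of copies of `V`; coordinate projections

Kernel annex of the Tier-5 record (blind lane).  N3.L5(a) uses: «`σ_v ⊗ σ^v` is, as a `G_v`-module,
an algebraic direct sum of copies of `σ_v`, and composing with a coordinate projection that does not
kill the image gives `0 ≠ Λ′_v`».  With a basis `𝒞 = (w_i)` of the second factor `W`
(Mathlib's `TensorProduct.equivFinsuppOfBasisRight 𝒞 : V ⊗ W ≃ₗ (κ →₀ V)`):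

* `coordProj 𝒞 i : V ⊗ W →ₗ V`, `v ⊗ w ↦ 𝒞.repr w i • v` (`coordProj_tmul`);
* the coordinate projections are jointly injective (`eq_zero_of_forall_coordProj_eq_zero`,
  `exists_coordProj_ne_zero`): `V ⊗ W = ⊕_i V`;
* they are `G`-equivariant for `G` acting on the first factor only
  (`coordProj_map_tmul`, `coordProj_map`);
* for a non-zero linear map `Λ : U → V ⊗ W` some `coordProj 𝒞 i ∘ Λ` is non-zero
  (`exists_coordProj_comp_ne_zero`), and it is `G`-equivariant when `Λ` is
  (`coordProj_comp_equivariant`).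

What stays prose: that the restricted tensor product of the record is an algebraic tensor product
`σ_v ⊗ σ^v` with `G_v` acting on the first factor; the printed theorems.
-/

namespace Summit.Ventures.HodgeRepro2.T5TensorCoordinateProjection

open TensorProduct

variable {k : Type*} [Field k] {V : Type*} [AddCommGroup V] [Module k V]
  {W : Type*} [AddCommGroup W] [Module k W] {κ : Type*} [DecidableEq κ]

/-- The coordinate projection `V ⊗ W → V` attached to the basis vector `w_i` of `W`:
`v ⊗ w ↦ 𝒞.repr w i • v`. -/
noncomputable def coordProj (𝒞 : Module.Basis κ k W) (i : κ) : V ⊗[k] W →ₗ[k] V :=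
  (Finsupp.lapply i) ∘ₗ (TensorProduct.equivFinsuppOfBasisRight 𝒞 : V ⊗[k] W ≃ₗ[k] κ →₀ V).toLinearMap

/-- `coordProj 𝒞 i (v ⊗ w) = 𝒞.repr w i • v`. -/
theorem coordProj_tmul (𝒞 : Module.Basis κ k W) (i : κ) (v : V) (w : W) :
    coordProj 𝒞 i (v ⊗ₜ[k] w) = 𝒞.repr w i • v := by
  simp only [coordProj, LinearMap.comp_apply, LinearEquiv.coe_coe, Finsupp.lapply_apply,
    TensorProduct.equivFinsuppOfBasisRight_apply_tmul_apply]

/-- `coordProj 𝒞 i (v ⊗ w_j) = v` if `i = j`, `0` otherwise. -/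
theorem coordProj_tmul_basis (𝒞 : Module.Basis κ k W) (i j : κ) (v : V) :
    coordProj 𝒞 i (v ⊗ₜ[k] 𝒞 j) = if i = j then v else 0 := by
  rw [coordProj_tmul, Module.Basis.repr_self, Finsupp.single_apply]
  by_cases h : j = i
  · subst h; simp only [if_true, one_smul]
  · rw [if_neg h, if_neg (Ne.symm h), zero_smul]

/-- The coordinate projections are jointly injective: `x = 0` iff every `coordProj 𝒞 i x = 0`. -/
theorem eq_zero_of_forall_coordProj_eq_zero (𝒞 : Module.Basis κ k W) {x : V ⊗[k] W}
    (h : ∀ i, coordProj 𝒞 i x = 0) : x = 0 := by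
  apply (TensorProduct.equivFinsuppOfBasisRight 𝒞).injective
  rw [map_zero]
  ext i
  exact h i

/-- A non-zero `x ∈ V ⊗ W` has a non-zero coordinate. -/
theorem exists_coordProj_ne_zero (𝒞 : Module.Basis κ k W) {x : V ⊗[k] W} (hx : x ≠ 0) :
    ∃ i, coordProj 𝒞 i x ≠ 0 := by
  by_contra h
  exact hx (eq_zero_of_forall_coordProj_eq_zero 𝒞 (fun i => by
    by_contra hi
    exact h ⟨i, hi⟩))

/-- Two elements of `V ⊗ W` with the same coordinates are equal. -/
theorem ext_coordProj (𝒞 : Module.Basis κ k W) {x y : V ⊗[k] W}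
    (h : ∀ i, coordProj 𝒞 i x = coordProj 𝒞 i y) : x = y := by
  rw [← sub_eq_zero]
  exact eq_zero_of_forall_coordProj_eq_zero 𝒞 (fun i => by rw [map_sub, h i, sub_self])

section Equivariance

variable {G : Type*} [Group G] (ρ : Representation k G V)

/-- For `G` acting on the first factor only, the coordinate projections are `G`-equivariant
(on pure tensors). -/
theorem coordProj_map_tmul (𝒞 : Module.Basis κ k W) (i : κ) (g : G) (v : V) (w : W) :
    coordProj 𝒞 i (TensorProduct.map (ρ g) LinearMap.id (v ⊗ₜ[k] w)) =
      ρ g (coordProj 𝒞 i (v ⊗ₜ[k] w)) := by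
  rw [TensorProduct.map_tmul, LinearMap.id_apply, coordProj_tmul, coordProj_tmul, map_smul]

/-- For `G` acting on the first factor only, the coordinate projections are `G`-equivariant. -/
theorem coordProj_map (𝒞 : Module.Basis κ k W) (i : κ) (g : G) (x : V ⊗[k] W) :
    coordProj 𝒞 i (TensorProduct.map (ρ g) LinearMap.id x) = ρ g (coordProj 𝒞 i x) := by
  induction x using TensorProduct.induction_on with
  | zero => simp only [map_zero]
  | tmul v w => exact coordProj_map_tmul ρ 𝒞 i g v w
  | add x y hx hy => rw [map_add, map_add, hx, hy, map_add, map_add]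

/-- A non-zero linear map `Λ : U → V ⊗ W` has a coordinate projection not killing its image. -/
theorem exists_coordProj_comp_ne_zero (𝒞 : Module.Basis κ k W) {U : Type*} [AddCommGroup U]
    [Module k U] {Λ : U →ₗ[k] V ⊗[k] W} (hΛ : Λ ≠ 0) : ∃ i, coordProj 𝒞 i ∘ₗ Λ ≠ 0 := by
  obtain ⟨u, hu⟩ : ∃ u, Λ u ≠ 0 := by
    by_contra h
    exact hΛ (LinearMap.ext fun u => by
      by_contra hu
      exact h ⟨u, hu⟩)
  obtain ⟨i, hi⟩ := exists_coordProj_ne_zero 𝒞 hu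
  refine ⟨i, fun h0 => hi ?_⟩
  have := LinearMap.congr_fun h0 u
  simpa only [LinearMap.comp_apply, LinearMap.zero_apply] using this

/-- The composite of a `G`-equivariant `Λ : U → V ⊗ W` (`G` on `V` alone) with a coordinate
projection is `G`-equivariant `U → V`. -/
theorem coordProj_comp_equivariant (𝒞 : Module.Basis κ k W) {U : Type*} [AddCommGroup U]
    [Module k U] (π : Representation k G U) (Λ : U →ₗ[k] V ⊗[k] W)
    (hΛ : ∀ (g : G) (u : U), Λ (π g u) = TensorProduct.map (ρ g) LinearMap.id (Λ u)) (i : κ)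
    (g : G) (u : U) : (coordProj 𝒞 i ∘ₗ Λ) (π g u) = ρ g ((coordProj 𝒞 i ∘ₗ Λ) u) := by
  simp only [LinearMap.comp_apply]
  rw [hΛ, coordProj_map]

/-- **N3.L5(a)'s coordinate step**: a non-zero `G`-equivariant `Λ : U → V ⊗ W` (`G` acting on `V`
alone) yields a non-zero `G`-equivariant map `U → V`. -/
theorem exists_equivariant_ne_zero (𝒞 : Module.Basis κ k W) {U : Type*} [AddCommGroup U]
    [Module k U] (π : Representation k G U) {Λ : U →ₗ[k] V ⊗[k] W} (hΛ0 : Λ ≠ 0)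
    (hΛ : ∀ (g : G) (u : U), Λ (π g u) = TensorProduct.map (ρ g) LinearMap.id (Λ u)) :
    ∃ Λ' : U →ₗ[k] V, Λ' ≠ 0 ∧ ∀ (g : G) (u : U), Λ' (π g u) = ρ g (Λ' u) := by
  obtain ⟨i, hi⟩ := exists_coordProj_comp_ne_zero 𝒞 hΛ0
  exact ⟨coordProj 𝒞 i ∘ₗ Λ, hi, coordProj_comp_equivariant ρ 𝒞 π Λ hΛ i⟩

end Equivariance

end Summit.Ventures.HodgeRepro2.T5TensorCoordinateProjection
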